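import Literature.Analysis.InverseSpectral.KreinStringWeylAnalytic
import Literature.Analysis.InverseSpectral.StieltjesRepresentation
import Literature.Analysis.Complex.PickFunctionsProofs
import HarnessLib

/-!
# Kreĭn strings: part (i) of Kreĭn's inverse spectral theorem

For every Kreĭn string `S[m, L]` other than the free half-line `S[0, ∞]`:

* the limit `q_S(z) = lim_{x → L} ψ(x,z)/φ(x,z)` exists for every `z ∈ ℂ ∖ [0, ∞)`
  (`KreinString.tendsto_principalWeylFunction`, unconditional), and
* `q_S ∈ N_S`, i.e. `q_S(z) = b + ∫_{[0,∞)} dσ(λ)/(λ - z)` with `b ≥ 0`, `∫ dσ/(1+λ) < ∞`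
  (`KreinString.isNevanlinnaStieltjes_principalWeylFunction`), from the function-theoretic
  properties of `q_S` (`KreinStringWeylAnalytic`: holomorphic off `[0,∞)`, `Im q_S · Im z ≥ 0`,
  real and positive on `(-∞,0)`, conjugation-symmetric) and the Stieltjes representation of
  Kreĭn's class `(S)` (`StieltjesRepresentation`), the latter from Nevanlinna's representation of
  the Pick class (`Literature.Analysis.Complex.nevanlinna_representation_holds`, Rosenblum–Rovnyak
  1985 Appendix §6 Theorem B, discharged in `PickFunctionsProofs`).

`krein_theorem_part_one` is literally the first conjunct of `KreinInverseSpectralTheorem`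
(unconditional).

## References

KacKrein1974 (§§1–2, §10; Supplement I Theorem S1.5.1), Tomisaki1988 (§4), DymMcKean1976 (Ch. 5).
-/

open MeasureTheory Filter Set Topology
open scoped ComplexConjugate

noncomputable section

namespace Literature.Analysis.InverseSpectral

namespace KreinString

variable (S : KreinString)

/-- **`q_S ∈ N_S`** (part (i) of Kreĭn's theorem, second half): the principal Titchmarsh–Weyl
function of a Kreĭn string other than the free half-line is a Stieltjes function
`b + ∫_{[0,∞)} dσ(λ)/(λ - z)`, `b ≥ 0`, `∫ dσ/(1+λ) < ∞`.
[cite: KacKrein1974, §2; Tomisaki1988, §4 (4.2)] -/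
theorem isNevanlinnaStieltjes_principalWeylFunction (hS : ¬ S.IsTrivial) :
    IsNevanlinnaStieltjes S.principalWeylFunction := by
  refine isNevanlinnaStieltjes_of_nevanlinna_representation
    Literature.Analysis.Complex.nevanlinna_representation_holds
    (S.differentiableOn_principalWeylFunction hS) (fun z hz => ?_) (fun s hs => ?_)
    (fun s hs => ?_) (fun z hz => S.conj_principalWeylFunction hS hz)
  · have h1 := S.im_principalWeylFunction_mul_im_nonneg hS (Or.inl hz.ne')
    exact nonneg_of_mul_nonneg_left h1 hz
  · exact S.im_principalWeylFunction_of_neg hS (z := -(s : ℂ)) (by simp) (by simpa using hs)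
  · exact (S.tendsto_principalWeylFunction_of_neg hS (z := -(s : ℂ)) (by simp)
      (by simpa using hs)).2.1.le

/-- **Spectral data of a string** (unconditional form of `hasStieltjesRepresentation_of_krein`): for a
Kreĭn string other than the free half-line, `weylConstant S ≥ 0` and `spectralMeasure S` represent
`q_S`: `q_S(z) = b + ∫_{[0,∞)} dσ_S(λ)/(λ - z)` off `[0, ∞)`, `∫ dσ_S/(1+λ) < ∞`. In particular the
transition function `transitionFunction S` is built from genuine spectral data.
[cite: KacKrein1974, §2] -/
theorem hasStieltjesRepresentation (hS : ¬ S.IsTrivial) :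
    HasStieltjesRepresentation S.principalWeylFunction S.weylConstant S.spectralMeasure :=
  S.hasStieltjesRepresentation_spectralMeasure (S.isNevanlinnaStieltjes_principalWeylFunction hS)

end KreinString

/-- **Kreĭn's theorem, part (i)**: for every Kreĭn string other than the free half-line and
every `z ∉ [0, ∞)` the limit `q_S(z) = lim_{x→L} ψ(x,z)/φ(x,z)` exists, and `q_S ∈ N_S`. This is
the first conjunct of `KreinInverseSpectralTheorem`.
[cite: Tomisaki1988, §4 Theorem (M. G. Kreĭn); KacKrein1974, §2] -/
theorem krein_theorem_part_one :
    ∀ S : KreinString, ¬ S.IsTrivial →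
      (∀ z ∈ offNonnegAxis,
          Tendsto (fun x => S.psi z x / S.phi z x) S.toEnd (𝓝 (S.principalWeylFunction z))) ∧
        IsNevanlinnaStieltjes S.principalWeylFunction :=
  fun S hS => ⟨fun _ hz => S.tendsto_principalWeylFunction hS hz,
    S.isNevanlinnaStieltjes_principalWeylFunction hS⟩

end Literature.Analysis.InverseSpectral

end
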